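import Literature.MathematicalPhysics.QuantumLattice.TIDensityPhaseCoexistence
import HarnessLib

/-!
# The GRAND-CANONICAL (chemical-potential) reading of the single-density phase-coexistence laws: a grand-canonical
# ground / equilibrium state is a canonical one at its own density, `μ` is a tangent slope there, and a certified
# convexity defect of `e_ρ` (concavity defect of `P(β;ρ)`) is a certified JUMP-FREE WINDOW of `n(μ)` and a certified
# CHEMICAL-POTENTIAL GAP between the two excluded phases (model-free, every `d`, every finite-range `Ψ`)

Topic `Literature/MathematicalPhysics/QuantumLattice` (family `hubbard`; cell `pub/hubbard-downfold`, MO-S1 ↔ S2 seam «box ↦ one word»,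
filling direction = the Legendre pair `μ ↔ n`; written 2026-08-28 by hubbard-downfold-unc-2 g22). `TIDensityPhaseCoexistence` states the
competing-orders (phase-separation-exclusion) laws in the CANONICAL variable: a cap at the density `an₁ + bn₂` strictly below the chord of
two floors at `n₁ < n₂` (margin `M = af₁ + bf₂ − c > 0` at `T = 0`; `W − aQ₁ − bQ₂ > 0` in pressure units at `T ≥ 0`) excludes every
macroscopic mixture of a phase of density `≤ n₁` with one of density `≥ n₂`. Experiments and the grand-canonical certificates of the
tree live on the CONJUGATE axis `μ` (photoemission chemical-potential shift `μ(x)`; Markov certificates at `(β, μ)`). This file is the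
dictionary, for an arbitrary interaction `Ψ` on `ℤ^d` and ANY interaction `Γ` whose mean energy is the `μ`-shift of `Ψ`'s
(`e_Γ(σ) = e_Ψ(σ) − μρ(σ)` for every state `σ` — the pencil `Ψ − μ·n`, the tree's `hubbardTTPrimeMuInteraction`, `gcInteractionTT' … μ 0`,
or a field pencil shifted by `μ`; hypothesis `hΓ`, no definitional commitment):

* §0 four one-line real-variable lemmas: a tangent (sub- or super-gradient) inequality of a convex / concave function over a chord
  `[x, z]` is TRANSPORTED to every intermediate point `y` by one Jensen step (`ConvexOn.mul_sub_le_sub_of_tangent_left`, …).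
* §1 `T = 0` (`IsMeanEnergyMinimiser Γ`, Bratteli–Kishimoto–Robinson's translation-invariant ground states of `H − μN`):
  `IsMeanEnergyMinimiser.meanEnergy_eq_tiGroundEnergyDensityAt_of_muShift` — a grand-canonical ground state IS a canonical ground state
  at its density (`e_Ψ(ω) = e_{ρ(ω)}(Ψ)`); `…tiGroundEnergyDensityAt_add_mul_sub_le_of_muShift` — `μ` is a SUBGRADIENT of `ρ ↦ e_ρ(Ψ)` at
  `ρ(ω)`; one-sided transports `…mul_sub_le_sub_of_density_le` (`μ(m − n₁) ≤ e_m − e_{n₁}` for a ground state of density `≤ n₁ ≤ m`) and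
  `…sub_le_mul_sub_of_le_density`; **`margin_le_mul_sub_chemPot_of_isMeanEnergyMinimiser`**: if `μ₁` carries a grand-canonical ground state
  of density `≤ n₁` and `μ₂` one of density `≥ n₂`, then `a·b·(n₂ − n₁)·(μ₂ − μ₁) ≥ af₁ + bf₂ − c` — a CERTIFIED CHEMICAL-POTENTIAL GAP
  `Δμ ≥ M/(ab(n₂−n₁))`; hence **`IsMeanEnergyMinimiser.not_isMeanEnergyMinimiser_of_density_le_of_le_density`**: at ONE `μ` the
  grand-canonical ground states never contain both a state of density `≤ n₁` and one of density `≥ n₂` — the density `n(μ)` has NO JUMP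
  ACROSS `[n₁, n₂]` at any `μ` (the textbook phrasing of «no macroscopic phase separation between these phases»).
* §2 `T > 0` (`IsVarEquilibrium β Γ`, Araki–Moriya's solutions of the variational principle for `H − μN`; `d ≥ 1`): the same four facts with
  the canonical variational pressure `P(β,Ψ;ρ) = Ψ.varPressureAt β R ρ` (concave) and the supergradient `−βμ`:
  `IsVarEquilibrium.sub_mul_eq_varPressureAt_of_muShift`, `…varPressureAt_add_mul_le_of_muShift`, the one-sided transports, the gap
  **`pressureMargin_le_mul_sub_chemPot_of_isVarEquilibrium`** (`a·b·(n₂−n₁)·β(μ₂ − μ₁) ≥ W − aQ₁ − bQ₂`) and the one-`μ` exclusion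
  **`IsVarEquilibrium.not_isVarEquilibrium_of_density_le_of_le_density`**.

WHY THE CANONICAL FORMULATION IS THE EFFICIENT ONE (honest remark): excluding a density jump at an UNKNOWN `μ*` directly from grand-canonical
pressure windows needs windows along the whole `μ` axis; the Legendre route needs windows at THREE densities and excludes the jump at EVERY `μ`.
HONEST SCOPE: statements about translation-invariant mean-energy minimisers / variational equilibria (existence of exact ones is not claimed —
none is needed: the theorems are implications); exclusion of MACROSCOPIC coexistence only; the gap is a floor on `Δμ`, not an estimate; no
definition, no named fact, no number. Everything is PROVED, 0 sorry.

## Mathlib / tree search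
REUSED: `FermionInteraction.tiGroundEnergyDensityAt(_le_meanEnergy)`, `le_tiGroundEnergyDensityAt`, `varPressureAt`, `sub_mul_le_varPressureAt`,
`varPressureAt_le` (`TIGroundEnergyDensityCouplingFamilies`, `CanonicalVariationalPressure`); `IsTranslationInvariant.convexOn_tiGroundEnergyDensityAt_uIcc`,
`…concaveOn_varPressureAt_uIcc`, `exists_isTranslationInvariant_density_eq_of_mem_Icc` (`TIDensityPhaseCoexistence`); `IsMeanEnergyMinimiser`
(`InfVolFermionState`), `IsVarEquilibrium`, `FermionInteraction.sub_mul_le_varPressure` (`TIVariationalPressure`); Mathlib `ConvexOn`, `ConcaveOn`,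
`Set.uIcc`. The tree has the converse Lagrange-multiplier direction (`CanonicalClassChemicalPotential`: canonical minimiser ⇒ grand-canonical for
some `μ`) and the grand-canonical density coexistence INTERVAL (`HubbardTTPrimeGrandCanonicalDensityCoexistenceInterval`); `lean search` /
`rg 'IsVarEquilibrium.*tiGroundEnergyDensityAt|Minimiser.*varPressureAt|chemPot.*margin'` (2026-08-28): no grand-canonical reading of the exclusion laws.

## References
* R. B. Israel, *Convexity in the Theory of Lattice Gases* (1979), Thm. I.2.4 (tangent functionals ↔ equilibrium states), §V.1. [cite: Israel1979, Thm. I.2.4]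
* D. Ruelle, *Statistical Mechanics: Rigorous Results* (1969), §3.4 (the chemical potential as conjugate of the density). [cite: Ruelle1969, §3.4]
* O. Bratteli, A. Kishimoto, D. W. Robinson, Commun. Math. Phys. 64 (1978) 41, Thm. 2. [cite: BratteliKishimotoRobinson1978, Thm. 2 (condition 2)]
* H. Araki, H. Moriya, Rev. Math. Phys. 15 (2003) 93, Thm. 12.11. [cite: ArakiMoriya2003, Theorem 12.11]
* V. J. Emery, S. A. Kivelson, H. Q. Lin, Phys. Rev. Lett. 64 (1990) 475 (phase separation as a jump of `n(μ)`). [cite: EmeryKivelsonLin1990, pp. 475–476]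
* R. T. Rockafellar, *Convex Analysis* (1970), Thm. 24.1 (monotone one-sided derivatives). [cite: Rockafellar1970, Thm. 24.1]
-/

noncomputable section

open scoped ComplexOrder BigOperators

namespace Literature.MathematicalPhysics.QuantumLattice

open InfVolFermionState FermionInteraction Set

/-! ## §0  Tangent inequalities travel along one chord -/

/-- **Subgradient transport (convex, tangent at the LEFT end).** If `E` is convex on `s ∋ x, z`, `x ≤ y ≤ z`, `x < z`, and the tangent
inequality `E x + μ(z − x) ≤ E z` holds over the chord, then `μ(z − y) ≤ E z − E y`: one Jensen step at `y = θx + (1−θ)z`.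
[cite: Rockafellar1970, Thm. 24.1] -/
theorem ConvexOn.mul_sub_le_sub_of_tangent_left {s : Set ℝ} {E : ℝ → ℝ} (hE : ConvexOn ℝ s E) {x y z μ : ℝ}
    (hx : x ∈ s) (hz : z ∈ s) (hxy : x ≤ y) (hyz : y ≤ z) (hxz : x < z) (h : E x + μ * (z - x) ≤ E z) :
    μ * (z - y) ≤ E z - E y := by
  have hzx : 0 < z - x := sub_pos.2 hxz
  set θ := (z - y) / (z - x) with hθ
  have hθ0 : 0 ≤ θ := div_nonneg (sub_nonneg.2 hyz) hzx.le
  have hθ1 : θ ≤ 1 := by rw [hθ, div_le_one hzx]; linarith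
  have hθzx : θ * (z - x) = z - y := by rw [hθ, div_mul_cancel₀ _ hzx.ne']
  have hcomb : θ * x + (1 - θ) * z = y := by
    have e : θ * x + (1 - θ) * z = z - θ * (z - x) := by ring
    rw [e, hθzx]; ring
  have hJ := hE.2 hx hz hθ0 (sub_nonneg.2 hθ1) (by ring : θ + (1 - θ) = 1)
  simp only [smul_eq_mul] at hJ
  rw [hcomb] at hJ
  have k : θ * E x ≤ θ * (E z - μ * (z - x)) := mul_le_mul_of_nonneg_left (by linarith) hθ0
  have e2 : θ * (E z - μ * (z - x)) = θ * E z - μ * (z - y) := by rw [mul_sub, ← hθzx]; ring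
  rw [e2] at k
  linarith

/-- **Subgradient transport (convex, tangent at the RIGHT end).** If `E` is convex on `s ∋ x, z`, `x ≤ y ≤ z`, `x < z`, and
`E z + μ(x − z) ≤ E x` (the tangent at `z` evaluated at `x`), then `E y − E x ≤ μ(y − x)`. [cite: Rockafellar1970, Thm. 24.1] -/
theorem ConvexOn.sub_le_mul_sub_of_tangent_right {s : Set ℝ} {E : ℝ → ℝ} (hE : ConvexOn ℝ s E) {x y z μ : ℝ}
    (hx : x ∈ s) (hz : z ∈ s) (hxy : x ≤ y) (hyz : y ≤ z) (hxz : x < z) (h : E z + μ * (x - z) ≤ E x) :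
    E y - E x ≤ μ * (y - x) := by
  have hzx : 0 < z - x := sub_pos.2 hxz
  set θ := (z - y) / (z - x) with hθ
  have hθ0 : 0 ≤ θ := div_nonneg (sub_nonneg.2 hyz) hzx.le
  have hθ1 : θ ≤ 1 := by rw [hθ, div_le_one hzx]; linarith
  have hθzx : θ * (z - x) = z - y := by rw [hθ, div_mul_cancel₀ _ hzx.ne']
  have h1θ : (1 - θ) * (z - x) = y - x := by rw [sub_mul, one_mul, hθzx]; ring
  have hcomb : θ * x + (1 - θ) * z = y := by
    have e : θ * x + (1 - θ) * z = z - θ * (z - x) := by ring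
    rw [e, hθzx]; ring
  have hJ := hE.2 hx hz hθ0 (sub_nonneg.2 hθ1) (by ring : θ + (1 - θ) = 1)
  simp only [smul_eq_mul] at hJ
  rw [hcomb] at hJ
  have k : (1 - θ) * E z ≤ (1 - θ) * (E x + μ * (z - x)) := mul_le_mul_of_nonneg_left (by linarith) (sub_nonneg.2 hθ1)
  have e2 : (1 - θ) * (E x + μ * (z - x)) = (1 - θ) * E x + μ * (y - x) := by rw [mul_add, ← h1θ]; ring
  rw [e2] at k
  linarith

/-- **Supergradient transport (concave, tangent at the LEFT end).** If `P` is concave on `s ∋ x, z`, `x ≤ y ≤ z`, `x < z`, and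
`P z ≤ P x + g(z − x)`, then `P z − P y ≤ g(z − y)`. [cite: Rockafellar1970, Thm. 24.1] -/
theorem ConcaveOn.sub_le_mul_sub_of_tangent_left {s : Set ℝ} {P : ℝ → ℝ} (hP : ConcaveOn ℝ s P) {x y z g : ℝ}
    (hx : x ∈ s) (hz : z ∈ s) (hxy : x ≤ y) (hyz : y ≤ z) (hxz : x < z) (h : P z ≤ P x + g * (z - x)) :
    P z - P y ≤ g * (z - y) := by
  have hzx : 0 < z - x := sub_pos.2 hxz
  set θ := (z - y) / (z - x) with hθ
  have hθ0 : 0 ≤ θ := div_nonneg (sub_nonneg.2 hyz) hzx.le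
  have hθ1 : θ ≤ 1 := by rw [hθ, div_le_one hzx]; linarith
  have hθzx : θ * (z - x) = z - y := by rw [hθ, div_mul_cancel₀ _ hzx.ne']
  have hcomb : θ * x + (1 - θ) * z = y := by
    have e : θ * x + (1 - θ) * z = z - θ * (z - x) := by ring
    rw [e, hθzx]; ring
  have hJ := hP.2 hx hz hθ0 (sub_nonneg.2 hθ1) (by ring : θ + (1 - θ) = 1)
  simp only [smul_eq_mul] at hJ
  rw [hcomb] at hJ
  have k : θ * (P z - g * (z - x)) ≤ θ * P x := mul_le_mul_of_nonneg_left (by linarith) hθ0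
  have e2 : θ * (P z - g * (z - x)) = θ * P z - g * (z - y) := by rw [mul_sub, ← hθzx]; ring
  rw [e2] at k
  linarith

/-- **Supergradient transport (concave, tangent at the RIGHT end).** If `P` is concave on `s ∋ x, z`, `x ≤ y ≤ z`, `x < z`, and
`P x ≤ P z + g(x − z)`, then `g(y − x) ≤ P y − P x`. [cite: Rockafellar1970, Thm. 24.1] -/
theorem ConcaveOn.mul_sub_le_sub_of_tangent_right {s : Set ℝ} {P : ℝ → ℝ} (hP : ConcaveOn ℝ s P) {x y z g : ℝ}
    (hx : x ∈ s) (hz : z ∈ s) (hxy : x ≤ y) (hyz : y ≤ z) (hxz : x < z) (h : P x ≤ P z + g * (x - z)) :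
    g * (y - x) ≤ P y - P x := by
  have hzx : 0 < z - x := sub_pos.2 hxz
  set θ := (z - y) / (z - x) with hθ
  have hθ0 : 0 ≤ θ := div_nonneg (sub_nonneg.2 hyz) hzx.le
  have hθ1 : θ ≤ 1 := by rw [hθ, div_le_one hzx]; linarith
  have hθzx : θ * (z - x) = z - y := by rw [hθ, div_mul_cancel₀ _ hzx.ne']
  have h1θ : (1 - θ) * (z - x) = y - x := by rw [sub_mul, one_mul, hθzx]; ring
  have hcomb : θ * x + (1 - θ) * z = y := by
    have e : θ * x + (1 - θ) * z = z - θ * (z - x) := by ring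
    rw [e, hθzx]; ring
  have hJ := hP.2 hx hz hθ0 (sub_nonneg.2 hθ1) (by ring : θ + (1 - θ) = 1)
  simp only [smul_eq_mul] at hJ
  rw [hcomb] at hJ
  have k : (1 - θ) * (P x - g * (x - z)) ≤ (1 - θ) * P z := mul_le_mul_of_nonneg_left (by linarith) (sub_nonneg.2 hθ1)
  have e2 : (1 - θ) * (P x - g * (x - z)) = (1 - θ) * P x + g * (y - x) := by rw [mul_sub, ← h1θ]; ring
  rw [e2] at k
  linarith

/-- Weights: `a n₁ + b n₂ ∈ [n₁, n₂]` with `a n₁ + b n₂ − n₁ = b(n₂ − n₁)` and `n₂ − (a n₁ + b n₂) = a(n₂ − n₁)` (`a + b = 1`). [folklore] -/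
private theorem convexComb_sub_eq {a b n₁ n₂ : ℝ} (hab : a + b = 1) :
    a * n₁ + b * n₂ - n₁ = b * (n₂ - n₁) ∧ n₂ - (a * n₁ + b * n₂) = a * (n₂ - n₁) := by
  constructor
  · linear_combination n₁ * hab
  · linear_combination (-n₂) * hab

namespace InfVolFermionState

/-! ## §1  `T = 0`: grand-canonical ground states (`IsMeanEnergyMinimiser` of a `μ`-shift `Γ` of `Ψ`) -/

section GroundStates

variable {d : ℕ} (Ψ : FermionInteraction d) (R : ℝ) {Γ : FermionInteraction d} {R' μ : ℝ} {ω ω₁ ω₂ σ : InfVolFermionState d}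

/-- **A grand-canonical ground state is a canonical ground state at its own density** (`T = 0` Legendre step): if `ω` minimises the mean
energy of a `μ`-shift `Γ` of `Ψ` (`e_Γ = e_Ψ − μρ`) over all translation-invariant states, then `e_Ψ(ω) = e_{ρ(ω)}(Ψ)`.
[cite: Ruelle1969, §3.4] [cite: BratteliKishimotoRobinson1978, Thm. 2 (condition 2)] -/
theorem IsMeanEnergyMinimiser.meanEnergy_eq_tiGroundEnergyDensityAt_of_muShift (hω : ω.IsMeanEnergyMinimiser Γ R')
    (hΓ : ∀ σ : InfVolFermionState d, σ.meanEnergy Γ R' = σ.meanEnergy Ψ R - μ * σ.density) :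
    ω.meanEnergy Ψ R = Ψ.tiGroundEnergyDensityAt R ω.density := by
  refine le_antisymm ?_ (Ψ.tiGroundEnergyDensityAt_le_meanEnergy R hω.1 rfl)
  refine Ψ.le_tiGroundEnergyDensityAt R ⟨ω, hω.1, rfl⟩ fun σ hσ hρ => ?_
  have h := hω.2 σ hσ
  rw [hΓ, hΓ, hρ] at h
  linarith

/-- **`μ` is a subgradient of `ρ ↦ e_ρ(Ψ)` at the density of a grand-canonical ground state**: `e_{ρ(ω)}(Ψ) + μ(n − ρ(ω)) ≤ e_n(Ψ)` at
every realised density `n`. [cite: Ruelle1969, §3.4] [cite: Israel1979, Thm. I.2.4] -/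
theorem IsMeanEnergyMinimiser.tiGroundEnergyDensityAt_add_mul_sub_le_of_muShift (hω : ω.IsMeanEnergyMinimiser Γ R')
    (hΓ : ∀ σ : InfVolFermionState d, σ.meanEnergy Γ R' = σ.meanEnergy Ψ R - μ * σ.density) {n : ℝ}
    (hn : ∃ σ : InfVolFermionState d, σ.IsTranslationInvariant ∧ σ.density = n) :
    Ψ.tiGroundEnergyDensityAt R ω.density + μ * (n - ω.density) ≤ Ψ.tiGroundEnergyDensityAt R n := by
  rw [← hω.meanEnergy_eq_tiGroundEnergyDensityAt_of_muShift Ψ R hΓ]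
  refine Ψ.le_tiGroundEnergyDensityAt R hn fun σ hσ hρ => ?_
  have h := hω.2 σ hσ
  rw [hΓ, hΓ, hρ] at h
  linarith

/-- **Upper transport of `μ` (ground state of LOW density).** A grand-canonical ground state `ω` at `μ` with `ρ(ω) ≤ n₁ ≤ m`, and some
translation-invariant `σ` with `m ≤ ρ(σ)` (so that every density in between is realised): `μ·(m − n₁) ≤ e_m(Ψ) − e_{n₁}(Ψ)` — the subgradient at
`ρ(ω)` is below every later secant slope (convexity of `e_ρ`). [cite: Ruelle1969, §3.4] [cite: Rockafellar1970, Thm. 24.1] -/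
theorem IsMeanEnergyMinimiser.mul_sub_le_sub_of_density_le (hω : ω.IsMeanEnergyMinimiser Γ R')
    (hΓ : ∀ σ : InfVolFermionState d, σ.meanEnergy Γ R' = σ.meanEnergy Ψ R - μ * σ.density)
    (hσ : σ.IsTranslationInvariant) {n₁ m : ℝ} (hn₁ : ω.density ≤ n₁) (hnm : n₁ ≤ m) (hm : m ≤ σ.density) :
    μ * (m - n₁) ≤ Ψ.tiGroundEnergyDensityAt R m - Ψ.tiGroundEnergyDensityAt R n₁ := by
  rcases eq_or_lt_of_le (hn₁.trans hnm) with heq | hlt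
  · have e1 : n₁ = m := le_antisymm hnm (heq ▸ hn₁)
    rw [e1, sub_self, sub_self, mul_zero]
  have hconv := hω.1.convexOn_tiGroundEnergyDensityAt_uIcc Ψ R hσ
  have hx : ω.density ∈ Set.uIcc ω.density σ.density := Set.left_mem_uIcc
  have hz : m ∈ Set.uIcc ω.density σ.density := Set.mem_uIcc.2 (Or.inl ⟨hlt.le, hm⟩)
  have hreal : ∃ τ : InfVolFermionState d, τ.IsTranslationInvariant ∧ τ.density = m :=
    exists_isTranslationInvariant_density_eq_of_mem_Icc hω.1 hσ ⟨hlt.le, hm⟩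
  have ht := hω.tiGroundEnergyDensityAt_add_mul_sub_le_of_muShift Ψ R hΓ hreal
  exact ConvexOn.mul_sub_le_sub_of_tangent_left hconv hx hz hn₁ hnm hlt ht

/-- **Lower transport of `μ` (ground state of HIGH density).** A grand-canonical ground state `ω` at `μ` with `m ≤ n₂ ≤ ρ(ω)`, and some
translation-invariant `σ` with `ρ(σ) ≤ m`: `e_{n₂}(Ψ) − e_m(Ψ) ≤ μ·(n₂ − m)`. [cite: Ruelle1969, §3.4] [cite: Rockafellar1970, Thm. 24.1] -/
theorem IsMeanEnergyMinimiser.sub_le_mul_sub_of_le_density (hω : ω.IsMeanEnergyMinimiser Γ R')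
    (hΓ : ∀ σ : InfVolFermionState d, σ.meanEnergy Γ R' = σ.meanEnergy Ψ R - μ * σ.density)
    (hσ : σ.IsTranslationInvariant) {m n₂ : ℝ} (hm : σ.density ≤ m) (hmn : m ≤ n₂) (hn₂ : n₂ ≤ ω.density) :
    Ψ.tiGroundEnergyDensityAt R n₂ - Ψ.tiGroundEnergyDensityAt R m ≤ μ * (n₂ - m) := by
  rcases eq_or_lt_of_le (hmn.trans hn₂) with heq | hlt
  · have e1 : m = n₂ := le_antisymm hmn (heq ▸ hn₂)
    rw [e1, sub_self, sub_self, mul_zero]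
  have hconv := hσ.convexOn_tiGroundEnergyDensityAt_uIcc Ψ R hω.1
  have hz : ω.density ∈ Set.uIcc σ.density ω.density := Set.right_mem_uIcc
  have hx : m ∈ Set.uIcc σ.density ω.density := Set.mem_uIcc.2 (Or.inl ⟨hm, hlt.le⟩)
  have hreal : ∃ τ : InfVolFermionState d, τ.IsTranslationInvariant ∧ τ.density = m :=
    exists_isTranslationInvariant_density_eq_of_mem_Icc hσ hω.1 ⟨hm, hlt.le⟩
  have ht := hω.tiGroundEnergyDensityAt_add_mul_sub_le_of_muShift Ψ R hΓ hreal
  exact ConvexOn.sub_le_mul_sub_of_tangent_right hconv hx hz hmn hn₂ hlt (by linarith)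

variable {Γ₁ Γ₂ : FermionInteraction d} {R₁ R₂ μ₁ μ₂ : ℝ}

/-- **THE CERTIFIED CHEMICAL-POTENTIAL GAP (`T = 0`, model-free).** Translation-invariant grand-canonical ground states `ω₁` at `μ₁` (of a
`μ₁`-shift `Γ₁` of `Ψ`) with `ρ(ω₁) ≤ n₁` and `ω₂` at `μ₂` with `n₂ ≤ ρ(ω₂)`, `n₁ ≤ n₂`; weights `a, b ≥ 0`, `a + b = 1`; a CAP
`e_{an₁+bn₂}(Ψ) ≤ c` and FLOORS `f₁ ≤ e_{n₁}(Ψ)`, `f₂ ≤ e_{n₂}(Ψ)`. Then `a·b·(n₂ − n₁)·(μ₂ − μ₁) ≥ af₁ + bf₂ − c`: the exclusion margin of the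
single-density law is a floor on the chemical-potential distance between the two phases (`μ₁·b(n₂−n₁) ≤ c − f₁` and `f₂ − c ≤ μ₂·a(n₂−n₁)`).
[cite: Israel1979, Thm. I.2.4] [cite: EmeryKivelsonLin1990, pp. 475–476] -/
theorem margin_le_mul_sub_chemPot_of_isMeanEnergyMinimiser (hω₁ : ω₁.IsMeanEnergyMinimiser Γ₁ R₁)
    (hΓ₁ : ∀ σ : InfVolFermionState d, σ.meanEnergy Γ₁ R₁ = σ.meanEnergy Ψ R - μ₁ * σ.density)
    (hω₂ : ω₂.IsMeanEnergyMinimiser Γ₂ R₂)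
    (hΓ₂ : ∀ σ : InfVolFermionState d, σ.meanEnergy Γ₂ R₂ = σ.meanEnergy Ψ R - μ₂ * σ.density)
    {n₁ n₂ : ℝ} (hn₁ : ω₁.density ≤ n₁) (hn : n₁ ≤ n₂) (hn₂ : n₂ ≤ ω₂.density)
    {a b : ℝ} (ha : 0 ≤ a) (hb : 0 ≤ b) (hab : a + b = 1) {c f₁ f₂ : ℝ}
    (hcap : Ψ.tiGroundEnergyDensityAt R (a * n₁ + b * n₂) ≤ c)
    (hf₁ : f₁ ≤ Ψ.tiGroundEnergyDensityAt R n₁) (hf₂ : f₂ ≤ Ψ.tiGroundEnergyDensityAt R n₂) :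
    a * f₁ + b * f₂ - c ≤ a * b * (n₂ - n₁) * (μ₂ - μ₁) := by
  obtain ⟨e1, e2⟩ := convexComb_sub_eq (n₁ := n₁) (n₂ := n₂) hab
  have hm1 : n₁ ≤ a * n₁ + b * n₂ := by rw [← sub_nonneg, e1]; exact mul_nonneg hb (sub_nonneg.2 hn)
  have hm2 : a * n₁ + b * n₂ ≤ n₂ := by rw [← sub_nonneg, e2]; exact mul_nonneg ha (sub_nonneg.2 hn)
  have k1 := hω₁.mul_sub_le_sub_of_density_le Ψ R hΓ₁ hω₂.1 hn₁ hm1 (hm2.trans hn₂)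
  have k2 := hω₂.sub_le_mul_sub_of_le_density Ψ R hΓ₂ hω₁.1 (hn₁.trans hm1) hm2 hn₂
  rw [e1] at k1
  rw [e2] at k2
  have k1' : μ₁ * (b * (n₂ - n₁)) ≤ c - f₁ := by linarith
  have k2' : f₂ - c ≤ μ₂ * (a * (n₂ - n₁)) := by linarith
  have A := mul_le_mul_of_nonneg_left k1' ha
  have B := mul_le_mul_of_nonneg_left k2' hb
  have hc' : a * c + b * c = c := by linear_combination c * hab
  nlinarith [A, B, hc']

/-- **Division form of the gap** (`a, b > 0`, `n₁ < n₂`): `μ₂ − μ₁ ≥ (af₁ + bf₂ − c)/(a b (n₂ − n₁))`. [cite: Israel1979, Thm. I.2.4] -/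
theorem div_le_sub_chemPot_of_isMeanEnergyMinimiser (hω₁ : ω₁.IsMeanEnergyMinimiser Γ₁ R₁)
    (hΓ₁ : ∀ σ : InfVolFermionState d, σ.meanEnergy Γ₁ R₁ = σ.meanEnergy Ψ R - μ₁ * σ.density)
    (hω₂ : ω₂.IsMeanEnergyMinimiser Γ₂ R₂)
    (hΓ₂ : ∀ σ : InfVolFermionState d, σ.meanEnergy Γ₂ R₂ = σ.meanEnergy Ψ R - μ₂ * σ.density)
    {n₁ n₂ : ℝ} (hn₁ : ω₁.density ≤ n₁) (hn : n₁ < n₂) (hn₂ : n₂ ≤ ω₂.density)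
    {a b : ℝ} (ha : 0 < a) (hb : 0 < b) (hab : a + b = 1) {c f₁ f₂ : ℝ}
    (hcap : Ψ.tiGroundEnergyDensityAt R (a * n₁ + b * n₂) ≤ c)
    (hf₁ : f₁ ≤ Ψ.tiGroundEnergyDensityAt R n₁) (hf₂ : f₂ ≤ Ψ.tiGroundEnergyDensityAt R n₂) :
    (a * f₁ + b * f₂ - c) / (a * b * (n₂ - n₁)) ≤ μ₂ - μ₁ := by
  have hpos : 0 < a * b * (n₂ - n₁) := by positivity
  rw [div_le_iff₀ hpos]
  have h := margin_le_mul_sub_chemPot_of_isMeanEnergyMinimiser Ψ R hω₁ hΓ₁ hω₂ hΓ₂ hn₁ hn.le hn₂ ha.le hb.le hab hcap hf₁ hf₂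
  linarith

/-- **NO DENSITY JUMP ACROSS `[n₁, n₂]` AT ANY `μ` (`T = 0`, model-free).** With a POSITIVE exclusion margin `c < af₁ + bf₂` (cap at
`an₁ + bn₂`, floors at `n₁ ≤ n₂`): if one translation-invariant grand-canonical ground state at `μ` has density `≤ n₁`, then NO
translation-invariant grand-canonical ground state at the same `μ` has density `≥ n₂` — the grand-canonical reading of
`tiGroundEnergyDensityAt_lt_meanEnergy_mix_of_cap_lt_floors_of_le`. [cite: Israel1979, Thm. I.2.4] [cite: EmeryKivelsonLin1990, pp. 475–476] -/
theorem IsMeanEnergyMinimiser.not_isMeanEnergyMinimiser_of_density_le_of_le_density (hω₁ : ω₁.IsMeanEnergyMinimiser Γ R')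
    (hΓ : ∀ σ : InfVolFermionState d, σ.meanEnergy Γ R' = σ.meanEnergy Ψ R - μ * σ.density) {n₁ n₂ : ℝ} (hn₁ : ω₁.density ≤ n₁) (hn : n₁ ≤ n₂) (hn₂ : n₂ ≤ ω₂.density)
    {a b : ℝ} (ha : 0 ≤ a) (hb : 0 ≤ b) (hab : a + b = 1) {c f₁ f₂ : ℝ}
    (hcap : Ψ.tiGroundEnergyDensityAt R (a * n₁ + b * n₂) ≤ c)
    (hf₁ : f₁ ≤ Ψ.tiGroundEnergyDensityAt R n₁) (hf₂ : f₂ ≤ Ψ.tiGroundEnergyDensityAt R n₂) (hc : c < a * f₁ + b * f₂) :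
    ¬ ω₂.IsMeanEnergyMinimiser Γ R' := by
  intro hω₂
  have h := margin_le_mul_sub_chemPot_of_isMeanEnergyMinimiser Ψ R hω₁ hΓ hω₂ hΓ hn₁ hn hn₂ ha hb hab hcap hf₁ hf₂
  rw [sub_self, mul_zero] at h
  linarith

/-- **Density localisation from above (`T = 0`).** A grand-canonical ground state at `μ` with `μ·b(n₂ − n₁) > c − f₁` (cap at `an₁ + bn₂`,
floor at `n₁`; some translation-invariant state of density `≥ an₁ + bn₂`) has density `> n₁`. [cite: Ruelle1969, §3.4] -/
theorem IsMeanEnergyMinimiser.lt_density_of_lt_mul (hω : ω.IsMeanEnergyMinimiser Γ R')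
    (hΓ : ∀ σ : InfVolFermionState d, σ.meanEnergy Γ R' = σ.meanEnergy Ψ R - μ * σ.density)
    (hσ : σ.IsTranslationInvariant) {n₁ n₂ : ℝ} (hn : n₁ ≤ n₂) {a b : ℝ} (hb : 0 ≤ b) (hab : a + b = 1)
    (hmσ : a * n₁ + b * n₂ ≤ σ.density) {c f₁ : ℝ} (hcap : Ψ.tiGroundEnergyDensityAt R (a * n₁ + b * n₂) ≤ c)
    (hf₁ : f₁ ≤ Ψ.tiGroundEnergyDensityAt R n₁) (hμ : c - f₁ < μ * (b * (n₂ - n₁))) :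
    n₁ < ω.density := by
  by_contra hle
  obtain ⟨e1, -⟩ := convexComb_sub_eq (n₁ := n₁) (n₂ := n₂) hab
  have hm1 : n₁ ≤ a * n₁ + b * n₂ := by rw [← sub_nonneg, e1]; exact mul_nonneg hb (sub_nonneg.2 hn)
  have k := hω.mul_sub_le_sub_of_density_le Ψ R hΓ hσ (le_of_not_gt hle) hm1 hmσ
  rw [e1] at k
  linarith

/-- **Density localisation from below (`T = 0`).** A grand-canonical ground state at `μ` with `μ·a(n₂ − n₁) < f₂ − c` (cap at `an₁ + bn₂`,
floor at `n₂`; some translation-invariant state of density `≤ an₁ + bn₂`) has density `< n₂`. [cite: Ruelle1969, §3.4] -/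
theorem IsMeanEnergyMinimiser.density_lt_of_mul_lt (hω : ω.IsMeanEnergyMinimiser Γ R')
    (hΓ : ∀ σ : InfVolFermionState d, σ.meanEnergy Γ R' = σ.meanEnergy Ψ R - μ * σ.density)
    (hσ : σ.IsTranslationInvariant) {n₁ n₂ : ℝ} (hn : n₁ ≤ n₂) {a b : ℝ} (ha : 0 ≤ a) (hab : a + b = 1)
    (hσm : σ.density ≤ a * n₁ + b * n₂) {c f₂ : ℝ} (hcap : Ψ.tiGroundEnergyDensityAt R (a * n₁ + b * n₂) ≤ c)
    (hf₂ : f₂ ≤ Ψ.tiGroundEnergyDensityAt R n₂) (hμ : μ * (a * (n₂ - n₁)) < f₂ - c) :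
    ω.density < n₂ := by
  by_contra hle
  obtain ⟨-, e2⟩ := convexComb_sub_eq (n₁ := n₁) (n₂ := n₂) hab
  have hm2 : a * n₁ + b * n₂ ≤ n₂ := by rw [← sub_nonneg, e2]; exact mul_nonneg ha (sub_nonneg.2 hn)
  have k := hω.sub_le_mul_sub_of_le_density Ψ R hΓ hσ hσm hm2 (le_of_not_gt hle)
  rw [e2] at k
  linarith

end GroundStates

/-! ## §2  `T > 0`: grand-canonical equilibrium states (`IsVarEquilibrium β Γ` of a `μ`-shift `Γ` of `Ψ`) -/

section Equilibria

variable {d : ℕ} (hd : 0 < d) (β : ℝ) (Ψ : FermionInteraction d) (R : ℝ) {Γ : FermionInteraction d} {R' μ : ℝ}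
  {ω ω₁ ω₂ σ : InfVolFermionState d}

/-- **A grand-canonical equilibrium state is a canonical equilibrium state at its own density** (`T > 0` Legendre step): if `ω` is a
variational equilibrium of a `μ`-shift `Γ` of `Ψ` at `β`, then `s̄(ω) − βe_Ψ(ω) = P(β,Ψ;ρ(ω))`. [cite: Israel1979, Thm. I.2.4] [cite: ArakiMoriya2003, Theorem 12.11] -/
theorem IsVarEquilibrium.sub_mul_eq_varPressureAt_of_muShift (hω : ω.IsVarEquilibrium β Γ R')
    (hΓ : ∀ σ : InfVolFermionState d, σ.meanEnergy Γ R' = σ.meanEnergy Ψ R - μ * σ.density) :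
    ω.entropyDensitySup - β * ω.meanEnergy Ψ R = Ψ.varPressureAt β R ω.density := by
  refine le_antisymm (Ψ.sub_mul_le_varPressureAt β R ω.density hω.1 rfl) ?_
  refine Ψ.varPressureAt_le β R ω.density ⟨ω, hω.1, rfl⟩ fun σ hσ hρ => ?_
  have h := Γ.sub_mul_le_varPressure β R' hσ
  rw [← hω.2, hΓ, hΓ, hρ] at h
  linarith

/-- **`−βμ` is a supergradient of `ρ ↦ P(β,Ψ;ρ)` at the density of a grand-canonical equilibrium state**:
`P(β,Ψ;n) + βμ(n − ρ(ω)) ≤ P(β,Ψ;ρ(ω))` at every realised density `n`. [cite: Israel1979, Thm. I.2.4] [cite: Ruelle1969, §3.4] -/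
theorem IsVarEquilibrium.varPressureAt_add_mul_le_of_muShift (hω : ω.IsVarEquilibrium β Γ R')
    (hΓ : ∀ σ : InfVolFermionState d, σ.meanEnergy Γ R' = σ.meanEnergy Ψ R - μ * σ.density) {n : ℝ}
    (hn : ∃ σ : InfVolFermionState d, σ.IsTranslationInvariant ∧ σ.density = n) :
    Ψ.varPressureAt β R n + β * μ * (n - ω.density) ≤ Ψ.varPressureAt β R ω.density := by
  rw [← hω.sub_mul_eq_varPressureAt_of_muShift β Ψ R hΓ]
  have key : Ψ.varPressureAt β R n ≤ ω.entropyDensitySup - β * ω.meanEnergy Ψ R - β * μ * (n - ω.density) := by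
    refine Ψ.varPressureAt_le β R n hn fun σ hσ hρ => ?_
    have h := Γ.sub_mul_le_varPressure β R' hσ
    rw [← hω.2, hΓ, hΓ, hρ] at h
    linarith
  linarith

include hd in
/-- **Upper transport of `βμ` (equilibrium of LOW density, `T > 0`).** An equilibrium `ω` at `(β, μ)` with `ρ(ω) ≤ n₁ ≤ m` and a
translation-invariant `σ` with `m ≤ ρ(σ)`: `βμ·(m − n₁) ≤ P(β,Ψ;n₁) − P(β,Ψ;m)` (concavity of `P(β,Ψ;·)`).
[cite: Israel1979, Thm. I.2.4] [cite: Rockafellar1970, Thm. 24.1] -/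
theorem IsVarEquilibrium.mul_sub_le_sub_of_density_le (hω : ω.IsVarEquilibrium β Γ R')
    (hΓ : ∀ σ : InfVolFermionState d, σ.meanEnergy Γ R' = σ.meanEnergy Ψ R - μ * σ.density)
    (hσ : σ.IsTranslationInvariant) {n₁ m : ℝ} (hn₁ : ω.density ≤ n₁) (hnm : n₁ ≤ m) (hm : m ≤ σ.density) :
    β * μ * (m - n₁) ≤ Ψ.varPressureAt β R n₁ - Ψ.varPressureAt β R m := by
  rcases eq_or_lt_of_le (hn₁.trans hnm) with heq | hlt
  · have e1 : n₁ = m := le_antisymm hnm (heq ▸ hn₁)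
    rw [e1, sub_self, sub_self, mul_zero]
  have hconc := hω.1.concaveOn_varPressureAt_uIcc hd β Ψ R hσ
  have hx : ω.density ∈ Set.uIcc ω.density σ.density := Set.left_mem_uIcc
  have hz : m ∈ Set.uIcc ω.density σ.density := Set.mem_uIcc.2 (Or.inl ⟨hlt.le, hm⟩)
  have hreal : ∃ τ : InfVolFermionState d, τ.IsTranslationInvariant ∧ τ.density = m :=
    exists_isTranslationInvariant_density_eq_of_mem_Icc hω.1 hσ ⟨hlt.le, hm⟩
  have ht := hω.varPressureAt_add_mul_le_of_muShift β Ψ R hΓ hreal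
  have k := ConcaveOn.sub_le_mul_sub_of_tangent_left hconc hx hz hn₁ hnm hlt (g := -(β * μ)) (by linarith)
  linarith

include hd in
/-- **Lower transport of `βμ` (equilibrium of HIGH density, `T > 0`).** An equilibrium `ω` at `(β, μ)` with `m ≤ n₂ ≤ ρ(ω)` and a
translation-invariant `σ` with `ρ(σ) ≤ m`: `P(β,Ψ;m) − P(β,Ψ;n₂) ≤ βμ·(n₂ − m)`. [cite: Israel1979, Thm. I.2.4] [cite: Rockafellar1970, Thm. 24.1] -/
theorem IsVarEquilibrium.sub_le_mul_sub_of_le_density (hω : ω.IsVarEquilibrium β Γ R')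
    (hΓ : ∀ σ : InfVolFermionState d, σ.meanEnergy Γ R' = σ.meanEnergy Ψ R - μ * σ.density)
    (hσ : σ.IsTranslationInvariant) {m n₂ : ℝ} (hm : σ.density ≤ m) (hmn : m ≤ n₂) (hn₂ : n₂ ≤ ω.density) :
    Ψ.varPressureAt β R m - Ψ.varPressureAt β R n₂ ≤ β * μ * (n₂ - m) := by
  rcases eq_or_lt_of_le (hmn.trans hn₂) with heq | hlt
  · have e1 : m = n₂ := le_antisymm hmn (heq ▸ hn₂)
    rw [e1, sub_self, sub_self, mul_zero]
  have hconc := hσ.concaveOn_varPressureAt_uIcc hd β Ψ R hω.1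
  have hz : ω.density ∈ Set.uIcc σ.density ω.density := Set.right_mem_uIcc
  have hx : m ∈ Set.uIcc σ.density ω.density := Set.mem_uIcc.2 (Or.inl ⟨hm, hlt.le⟩)
  have hreal : ∃ τ : InfVolFermionState d, τ.IsTranslationInvariant ∧ τ.density = m :=
    exists_isTranslationInvariant_density_eq_of_mem_Icc hσ hω.1 ⟨hm, hlt.le⟩
  have ht := hω.varPressureAt_add_mul_le_of_muShift β Ψ R hΓ hreal
  have k := ConcaveOn.mul_sub_le_sub_of_tangent_right hconc hx hz hmn hn₂ hlt (g := -(β * μ)) (by linarith)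
  linarith

variable {Γ₁ Γ₂ : FermionInteraction d} {R₁ R₂ μ₁ μ₂ : ℝ}

include hd in
/-- **THE CERTIFIED CHEMICAL-POTENTIAL GAP AT `T > 0` (model-free, `d ≥ 1`).** Equilibria `ω₁` at `(β, μ₁)` with `ρ(ω₁) ≤ n₁` and `ω₂` at
`(β, μ₂)` with `n₂ ≤ ρ(ω₂)` (`n₁ ≤ n₂`); weights `a, b ≥ 0`, `a + b = 1`; a pressure FLOOR `W ≤ P(β,Ψ; an₁ + bn₂)` and CAPS `P(β,Ψ;n₁) ≤ Q₁`,
`P(β,Ψ;n₂) ≤ Q₂`. Then `a·b·(n₂ − n₁)·β(μ₂ − μ₁) ≥ W − aQ₁ − bQ₂` (`βμ₁·b(n₂−n₁) ≤ Q₁ − W`, `W − Q₂ ≤ βμ₂·a(n₂−n₁)`).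
[cite: Israel1979, Thm. I.2.4] [cite: ArakiMoriya2003, Theorem 12.11] -/
theorem pressureMargin_le_mul_sub_chemPot_of_isVarEquilibrium (hω₁ : ω₁.IsVarEquilibrium β Γ₁ R₁)
    (hΓ₁ : ∀ σ : InfVolFermionState d, σ.meanEnergy Γ₁ R₁ = σ.meanEnergy Ψ R - μ₁ * σ.density)
    (hω₂ : ω₂.IsVarEquilibrium β Γ₂ R₂)
    (hΓ₂ : ∀ σ : InfVolFermionState d, σ.meanEnergy Γ₂ R₂ = σ.meanEnergy Ψ R - μ₂ * σ.density)
    {n₁ n₂ : ℝ} (hn₁ : ω₁.density ≤ n₁) (hn : n₁ ≤ n₂) (hn₂ : n₂ ≤ ω₂.density)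
    {a b : ℝ} (ha : 0 ≤ a) (hb : 0 ≤ b) (hab : a + b = 1) {W Q₁ Q₂ : ℝ}
    (hW : W ≤ Ψ.varPressureAt β R (a * n₁ + b * n₂))
    (hQ₁ : Ψ.varPressureAt β R n₁ ≤ Q₁) (hQ₂ : Ψ.varPressureAt β R n₂ ≤ Q₂) :
    W - a * Q₁ - b * Q₂ ≤ a * b * (n₂ - n₁) * (β * (μ₂ - μ₁)) := by
  obtain ⟨e1, e2⟩ := convexComb_sub_eq (n₁ := n₁) (n₂ := n₂) hab
  have hm1 : n₁ ≤ a * n₁ + b * n₂ := by rw [← sub_nonneg, e1]; exact mul_nonneg hb (sub_nonneg.2 hn)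
  have hm2 : a * n₁ + b * n₂ ≤ n₂ := by rw [← sub_nonneg, e2]; exact mul_nonneg ha (sub_nonneg.2 hn)
  have k1 := hω₁.mul_sub_le_sub_of_density_le hd β Ψ R hΓ₁ hω₂.1 hn₁ hm1 (hm2.trans hn₂)
  have k2 := hω₂.sub_le_mul_sub_of_le_density hd β Ψ R hΓ₂ hω₁.1 (hn₁.trans hm1) hm2 hn₂
  rw [e1] at k1
  rw [e2] at k2
  have k1' : β * μ₁ * (b * (n₂ - n₁)) ≤ Q₁ - W := by linarith
  have k2' : W - Q₂ ≤ β * μ₂ * (a * (n₂ - n₁)) := by linarith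
  have A := mul_le_mul_of_nonneg_left k1' ha
  have B := mul_le_mul_of_nonneg_left k2' hb
  have hW' : a * W + b * W = W := by linear_combination W * hab
  nlinarith [A, B, hW']

include hd in
/-- **Division form of the `T > 0` gap** (`a, b, β > 0`, `n₁ < n₂`): `μ₂ − μ₁ ≥ (W − aQ₁ − bQ₂)/(a b (n₂ − n₁) β)`. [cite: Israel1979, Thm. I.2.4] -/
theorem div_le_sub_chemPot_of_isVarEquilibrium (hβ : 0 < β) (hω₁ : ω₁.IsVarEquilibrium β Γ₁ R₁)
    (hΓ₁ : ∀ σ : InfVolFermionState d, σ.meanEnergy Γ₁ R₁ = σ.meanEnergy Ψ R - μ₁ * σ.density)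
    (hω₂ : ω₂.IsVarEquilibrium β Γ₂ R₂)
    (hΓ₂ : ∀ σ : InfVolFermionState d, σ.meanEnergy Γ₂ R₂ = σ.meanEnergy Ψ R - μ₂ * σ.density)
    {n₁ n₂ : ℝ} (hn₁ : ω₁.density ≤ n₁) (hn : n₁ < n₂) (hn₂ : n₂ ≤ ω₂.density)
    {a b : ℝ} (ha : 0 < a) (hb : 0 < b) (hab : a + b = 1) {W Q₁ Q₂ : ℝ}
    (hW : W ≤ Ψ.varPressureAt β R (a * n₁ + b * n₂))
    (hQ₁ : Ψ.varPressureAt β R n₁ ≤ Q₁) (hQ₂ : Ψ.varPressureAt β R n₂ ≤ Q₂) :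
    (W - a * Q₁ - b * Q₂) / (a * b * (n₂ - n₁) * β) ≤ μ₂ - μ₁ := by
  have hpos : 0 < a * b * (n₂ - n₁) * β := by
    have : 0 < n₂ - n₁ := sub_pos.2 hn
    positivity
  rw [div_le_iff₀ hpos]
  have h := pressureMargin_le_mul_sub_chemPot_of_isVarEquilibrium hd β Ψ R hω₁ hΓ₁ hω₂ hΓ₂ hn₁ hn.le hn₂ ha.le hb.le hab hW hQ₁ hQ₂
  linarith

include hd in
/-- **NO DENSITY JUMP ACROSS `[n₁, n₂]` AT ANY `μ` (`T > 0`, model-free).** With `aQ₁ + bQ₂ < W` (pressure caps at the outer densities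
strictly below the floor at `an₁ + bn₂`): if one grand-canonical equilibrium state at `(β, μ)` has density `≤ n₁`, NO grand-canonical
equilibrium state at the same `(β, μ)` has density `≥ n₂` — the grand-canonical reading of `sub_mul_lt_varPressureAt_mix_of_caps_lt_floor_of_le`;
the equilibrium density interval `[ρ₋(μ), ρ₊(μ)]` never contains `[n₁, n₂]`. [cite: Israel1979, Thm. I.2.4] [cite: ArakiMoriya2003, Theorem 12.11] -/
theorem IsVarEquilibrium.not_isVarEquilibrium_of_density_le_of_le_density (hω₁ : ω₁.IsVarEquilibrium β Γ R')
    (hΓ : ∀ σ : InfVolFermionState d, σ.meanEnergy Γ R' = σ.meanEnergy Ψ R - μ * σ.density) {n₁ n₂ : ℝ} (hn₁ : ω₁.density ≤ n₁) (hn : n₁ ≤ n₂) (hn₂ : n₂ ≤ ω₂.density)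
    {a b : ℝ} (ha : 0 ≤ a) (hb : 0 ≤ b) (hab : a + b = 1) {W Q₁ Q₂ : ℝ}
    (hW : W ≤ Ψ.varPressureAt β R (a * n₁ + b * n₂))
    (hQ₁ : Ψ.varPressureAt β R n₁ ≤ Q₁) (hQ₂ : Ψ.varPressureAt β R n₂ ≤ Q₂) (hlt : a * Q₁ + b * Q₂ < W) :
    ¬ ω₂.IsVarEquilibrium β Γ R' := by
  intro hω₂
  have h := pressureMargin_le_mul_sub_chemPot_of_isVarEquilibrium hd β Ψ R hω₁ hΓ hω₂ hΓ hn₁ hn hn₂ ha hb hab hW hQ₁ hQ₂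
  rw [sub_self, mul_zero, mul_zero] at h
  linarith

include hd in
/-- **Density localisation from above (`T > 0`).** An equilibrium at `(β, μ)` with `βμ·b(n₂ − n₁) > Q₁ − W` has density `> n₁`
(some translation-invariant state of density `≥ an₁ + bn₂`). [cite: Ruelle1969, §3.4] -/
theorem IsVarEquilibrium.lt_density_of_lt_mul (hω : ω.IsVarEquilibrium β Γ R')
    (hΓ : ∀ σ : InfVolFermionState d, σ.meanEnergy Γ R' = σ.meanEnergy Ψ R - μ * σ.density)
    (hσ : σ.IsTranslationInvariant) {n₁ n₂ : ℝ} (hn : n₁ ≤ n₂) {a b : ℝ} (hb : 0 ≤ b) (hab : a + b = 1)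
    (hmσ : a * n₁ + b * n₂ ≤ σ.density) {W Q₁ : ℝ} (hW : W ≤ Ψ.varPressureAt β R (a * n₁ + b * n₂))
    (hQ₁ : Ψ.varPressureAt β R n₁ ≤ Q₁) (hμ : Q₁ - W < β * μ * (b * (n₂ - n₁))) :
    n₁ < ω.density := by
  by_contra hle
  obtain ⟨e1, -⟩ := convexComb_sub_eq (n₁ := n₁) (n₂ := n₂) hab
  have hm1 : n₁ ≤ a * n₁ + b * n₂ := by rw [← sub_nonneg, e1]; exact mul_nonneg hb (sub_nonneg.2 hn)
  have k := hω.mul_sub_le_sub_of_density_le hd β Ψ R hΓ hσ (le_of_not_gt hle) hm1 hmσ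
  rw [e1] at k
  linarith

include hd in
/-- **Density localisation from below (`T > 0`).** An equilibrium at `(β, μ)` with `βμ·a(n₂ − n₁) < W − Q₂` has density `< n₂`
(some translation-invariant state of density `≤ an₁ + bn₂`). [cite: Ruelle1969, §3.4] -/
theorem IsVarEquilibrium.density_lt_of_mul_lt (hω : ω.IsVarEquilibrium β Γ R')
    (hΓ : ∀ σ : InfVolFermionState d, σ.meanEnergy Γ R' = σ.meanEnergy Ψ R - μ * σ.density)
    (hσ : σ.IsTranslationInvariant) {n₁ n₂ : ℝ} (hn : n₁ ≤ n₂) {a b : ℝ} (ha : 0 ≤ a) (hab : a + b = 1)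
    (hσm : σ.density ≤ a * n₁ + b * n₂) {W Q₂ : ℝ} (hW : W ≤ Ψ.varPressureAt β R (a * n₁ + b * n₂))
    (hQ₂ : Ψ.varPressureAt β R n₂ ≤ Q₂) (hμ : β * μ * (a * (n₂ - n₁)) < W - Q₂) :
    ω.density < n₂ := by
  by_contra hle
  obtain ⟨-, e2⟩ := convexComb_sub_eq (n₁ := n₁) (n₂ := n₂) hab
  have hm2 : a * n₁ + b * n₂ ≤ n₂ := by rw [← sub_nonneg, e2]; exact mul_nonneg ha (sub_nonneg.2 hn)
  have k := hω.sub_le_mul_sub_of_le_density hd β Ψ R hΓ hσ hσm hm2 (le_of_not_gt hle)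
  rw [e2] at k
  linarith

end Equilibria

end InfVolFermionState

end Literature.MathematicalPhysics.QuantumLattice

end
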